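import Summits.SmoothPoincare4.SmoothPoincare4.Theorems.DottedCircleRasmussenDcrRigidityReduction
import Summits.SmoothPoincare4.SmoothPoincare4.Theorems.DcrGap.Negative.KZeroIsFgmw

/-!
# Line `Sketch` — skeleton for crux `DottedCircleRasmussen.DcrRigidity` (item stmt-SmoothPoincare4-17014)

Lead `prover-line-stmt-SmoothPoincare4-17014-0`, 2026-08-16, reshape r1 of the planners' evidence
`20260816T225949Z-Sketch.lean` (= `Cruxes/DcrRigidity/SketchIdeator2.lean`) along card
`Cruxes/DcrRigidity/Ideas/invertible-sphere-transplant.md` (card A); r2 (wave 1 returned): K2 and P2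
LANDED; r3: the composition itself LANDED as `Theorems/DottedCircleRasmussenDcrRigidityReduction.lean`
(p131677: `dcrRigidity_of_schsplitPuncturedEmbeds : SchsplitPuncturedEmbeds → DcrRigidity`, a
CONDITIONAL result on the crux, plus the kill edge `not_schsplitPuncturedEmbeds_of_dcrGap`), imported
here, so this skeleton is CLOSED MODULO X: it rests on exactly ONE `sorry` — the open stub X.

Crux (fixed, never restated): `DcrRigidity := ¬ DcrGap` — every model circle `K ⊂ ∂D_k` that bounds a
smooth proper disc in the complement of `e(D_k)` inside SOME homotopy 4-sphere bounds such a disc in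
some `N ≅ S⁴`.

## The line: transplant through an `S⁴`-embeddable puncture

`DcrRigidity ⟸ INV` (every punctured homotopy 4-sphere embeds in `ℝ⁴`), and INV is VERBATIM the
staffed crux `SchoenfliesSplit.SchsplitPuncturedEmbeds` (item stmt-SmoothPoincare4-0371).  The
datum `(e, f)` is moved off a point `q` (shrink the chart, dimension count), corestricted to the
open submanifold `M ∖ {q}`, and carried into `S⁴` along `M ∖ {q} ↪ ℝ⁴ ↪ S⁴`.

Registered stubs:

* `stub_offPoint` (K2; M; LANDED p131320): a `D_k`-datum `(e, f)` in any smooth 4-manifold can be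
  re-chosen as `(e', f)` with the SAME disc and a point `q ∉ e'(ℝ⁴) ∪ f(ℝ²)` — shrink the chart to
  a bounded ball agreeing with `e` on `B(0, 8c) ⊇ D_k` (`exists_isSmoothEmbedding_eqOn_ball` after the
  homothety `c •`, `c = 5(k+1)+1`), then the dimension count `exists_lt_norm_apply_notMem_range`.
* `stub_invOfSchsplit` (P2; S; LANDED p131470): `SchsplitPuncturedEmbeds` (over `HomotopySphere 4`,
  target `ℝ⁴`) gives, for the route's `Type`-binder homotopy spheres, an embedding of every puncture
  into `S⁴` (package `CompactSpace`/orientation by the landed facts, compose with the inverse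
  stereographic chart).
* `stub_schsplitPuncturedEmbeds` (K1 = X; OPEN; = item stmt-SmoothPoincare4-0371 of route
  `SchoenfliesSplit`, verbatim): every punctured homotopy 4-sphere embeds smoothly in `ℝ⁴`.

Landed composition (imported, `Theorems/DottedCircleRasmussenDcrRigidityReduction.lean`, p131677):
`transplant_of_punctureEmbeds` (P1), `dcrRigidity_of_punctureEmbeds` (pointwise INV in `Type`-binder
form ⇒ crux, through K2), `dcrRigidity_of_schsplitPuncturedEmbeds` (X ⇒ crux, through K2 + P2),
`not_schsplitPuncturedEmbeds_of_dcrGap` (kill edge), `dcrRigidity_of_smoothPoincare4`.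
Proved here (no `sorry` of its own): `DcrRigidity_of` (the crux BY NAME = landed reduction fed with
X) and the hardness record `smoothPoincare4_sandwich` (`SmoothPoincare4 → DcrRigidity → ¬ FGMW-gap`,
lower edge from the landed `DcrGap.Negative.not_fgmw_of_not_dcrGap`).

## Disproof.lean honoured

No `Cruxes/DcrRigidity/Disproof.lean` is published yet (`ledger crux ls`, 2026-08-16T23:30Z), but the
standing disprover has LANDED `Theorems/DcrRigidity/Negative/NonInvertibleWitness.lean` and
`…/LoadBearing.lean` (23:20Z/23:25Z).  Read and used: (i) its `exists_nonInvertible_of_not_dcrRigidity`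
/ `not_forall_punctureEmbeds_of_not_dcrRigidity` are the CONTRAPOSITIVE of this line's composition
(a disproof needs a non-invertible witnessing sphere) — consistent with X = INV being the honest
apex, and confirming no cheaper hypothesis than invertibility OF THE WITNESSING SPHERE is visible;
(ii) `LoadBearing`: the conclusion's `≃ₘ` is load-bearing (`≃ₕ` makes the crux trivial), the
regularity clauses of `IsModelKnot` are implied by the datum, the round-chart strengthening is
equivalent — none of these touches a stub of this line (K2/P2 landed; X is hypothesis-side).  The
sibling crux's `Cruxes/DcrGap/Disproof.lean` (goal `¬ DcrGap` = this crux) records the same sandwich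
`SPC4 ⇒ ¬DcrGap ⇒ ¬FGMW` and the normal form `dcrRigidity_iff_modelForm`.
-/

noncomputable section

-- the prescribed namespace `Summit.<P>.<Sub>.…` duplicates `SmoothPoincare4` (P = Sub)
set_option linter.dupNamespace false

open scoped Manifold ContDiff Topology ContinuousMap
open Set Function Metric
open Literature.Topology.FourManifolds Literature.Topology.FourManifolds.MMSW
open Summit.SmoothPoincare4.SmoothPoincare4.Theses.DottedCircleRasmussen
open Summit.SmoothPoincare4.SmoothPoincare4.Theses.SchoenfliesSplit (SchsplitPuncturedEmbeds)

namespace Summit.SmoothPoincare4.SmoothPoincare4.Cruxes.DcrRigidity.Sketch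

/-! ## Stub K2 — LANDED: `stub_offPoint` (p131320,
`Theorems/DottedCircleRasmussenDcrRigidityStubOffPoint.lean`; wave 1) -/

/-! ## Stub P2 — LANDED: `stub_invOfSchsplit` (p131470,
`Theorems/DottedCircleRasmussenDcrRigidityStubInvOfSchsplit.lean`; wave 1) -/

/-! ## Composition — LANDED: `dcrRigidity_of_schsplitPuncturedEmbeds` etc. (p131677,
`Theorems/DottedCircleRasmussenDcrRigidityReduction.lean`, imported) -/

/-! ## Stub K1 = X — invertibility of homotopy 4-spheres (OPEN; item stmt-SmoothPoincare4-0371) -/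

/-- **K1 = X (`SchsplitPuncturedEmbeds`, the crux (A) of route `SchoenfliesSplit`, item
stmt-SmoothPoincare4-0371, VERBATIM).** Every punctured homotopy 4-sphere embeds smoothly in `ℝ⁴`
("every homotopy 4-sphere is invertible": `Σ ∖ pt ↪ ℝ⁴ ⟺ Σ ∖ ball ↪ S⁴ ⟺ ∃ Σ', Σ # Σ' ≅ S⁴`;
Freedman–Gompf–Morrison–Walker 2010 §1 fn. 1: SPC4 ⟺ INV ∧ Schoenflies⁴).  OPEN; implied by
`SmoothPoincare4`; no worker can move it — when item stmt-0371 closes, its `_holds` replaces this. -/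
theorem stub_schsplitPuncturedEmbeds : SchsplitPuncturedEmbeds := by
  sorry

/-! ## The composition (kernel-checked; no `sorry` of its own) -/

/-- **The line concludes the crux BY NAME**: the landed reduction
`dcrRigidity_of_schsplitPuncturedEmbeds` (K2 `stub_offPoint` + P2 `stub_invOfSchsplit` + transplant
P1, all landed) fed with the one open stub X. -/
theorem DcrRigidity_of :
    Summit.SmoothPoincare4.SmoothPoincare4.Theses.DottedCircleRasmussen.DcrRigidity :=
  dcrRigidity_of_schsplitPuncturedEmbeds stub_schsplitPuncturedEmbeds

/-! ## Hardness record (tree theorems only; no stub used) -/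

/-- **Sandwich `SmoothPoincare4 ⇒ DcrRigidity ⇒ ¬(FGMW gap)`.**  The upper edge is the landed
`dcrRigidity_of_smoothPoincare4` (contrapositive of the route's certified `closes`); the lower edge
is the landed `Theorems.DcrGap.Negative.not_fgmw_of_not_dcrGap` (`k = 0`: every knot slice in a
homotopy 4-ball is slice).  Both ends are open problems (MMSW Question 9.11 / Manolescu–Piccirillo
§1), so no stub short of SPC4-strength input closes the crux, and X = INV (⟸ SPC4) is the honest
apex. [folklore] -/
theorem smoothPoincare4_sandwich :
    (_root_.SmoothPoincare4 → DcrRigidity) ∧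
      (DcrRigidity → ¬ ∃ K : Knot, K.IsHomotopyBallSlice ∧ ¬ K.IsSmoothlySlice) :=
  ⟨dcrRigidity_of_smoothPoincare4, fun h => Theorems.DcrGap.Negative.not_fgmw_of_not_dcrGap h⟩

end Summit.SmoothPoincare4.SmoothPoincare4.Cruxes.DcrRigidity.Sketch

end
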